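import Summits.Parity.GeneralizedHardyLittlewood.Theorems.HeathBrownPrimeAP3ErrorTerm

/-! # HeathBrownPrimeAP3 (3/3) — F3, the read-out: `readoutAP_holds : ReadoutAP` (item stmt-Parity-19665), the
shared supports (19666, 19667), the Assembly (19668) and the TARGET `heathBrownPrimeAP3_holds : HeathBrownPrimeAP3`
(stmt-Parity-19662) of `route-Parity-HeathBrownPrimeAP3`

Ledger of record: tier A, ledger **FRONTIER**; no bearing on prime pairs / parity / GHL (tribunal J 2026-08-26).
If no Heath-Brown prime `π ∈ (N/2, N]` is the middle term of a non-trivial prime 3-AP then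
`T_{2N}(Λ, Λ, w) ≤ C″ (2N)^{3/2} (log 2N)^4` (`w = apWeight c N`; the surviving terms are the prime diagonal
`n₁ = n₂ = π` and those with a higher prime power; Chebyshev bounds of Mathlib). The closing section discharges E2 and E4b by the
Literature theorems and obtains the target through the route's deciding theorem `closes`. (Ladder remark, not
filed: the target gives infinitely many 3-term progressions of primes with a Heath-Brown middle term, hence
parity.S18.) Sources: [HeathBrownActa2001] (Theorem 1), [Nathanson1996] (§8.1), [GreenTao2006Restriction].

Theorems-side PORT of the cell evidence `pub/parity-ideate/parity-ideate-p2/evidence/LineEFG_tree.lean`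
(KERNEL-PROVED there, farm rc 0, axioms std), re-namespaced into the route namespace (precedent
`Theorems/MaynardProductExactGlue.lean`) and re-based on the LANDED Literature modules `CubicMinorantDefs`
(p407241: the weights `vmWeight`, `gWeight`, `hbWeight`, `apWeight`, `ternarySum`, `expSumOf`),
`TernaryHolderCounting` (E5, p410251), `RoughModelPairCount` (E6, p410680), `RoughModelFourierApprox`
(E2, p410505), `HeathBrownWeightFourthMoment` (E4b, p410644), whose public lemmas replace the evidence's local
copies. Notation: `T = ternarySum`, `Λ_N = vmWeight N`, `g_B = gWeight B N` (the `W`-rough model of level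
`(log N)^B` on `[1, N]`), `f₃ = hbWeight c N` (Heath-Brown primes `x³+2y³` from the box
`X < x, y ≤ X(1+η)`, `X = (N/6)^{1/3}`, `η = (log X)^{-c}`, weight `N^{1/3} log`). Port prepared and
farm-checked by parity-ideate-p2 g5 (planner); filed by a prover seat. -/

noncomputable section

open scoped FourierTransform ArithmeticFunction
open Finset MeasureTheory Filter

namespace Summit.Parity.GeneralizedHardyLittlewood.Theses.HeathBrownPrimeAP3

open Literature.NumberTheory.Sieve Literature.NumberTheory.Sieve.CubicPrimes
open Literature.NumberTheory.Sieve.CubicMinorant hiding RoughModelFourierApprox HBFourierFourthMoment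
  roughModelFourierApprox_holds hbFourierFourthMoment_holds
open Literature.NumberTheory.Waring.HuaCubes
open Summit.Parity.GeneralizedHardyLittlewood.Theses.VinogradovHeathBrown hiding RoughModelFourierApprox
  HBFourierFourthMoment roughModelFourierApprox_holds hbFourierFourthMoment_holds Assembly assembly_holds closes
open scoped Topology

section F3proof

open scoped Chebyshev
open ArithmeticFunction

/-- The mass of the AP weight: `∑_{k ≤ 2N} w(k) = ∑_{m ≤ N} f₃(m) ≤ 9 N log N` for `N ≥ 126`. [this line] -/
theorem sum_apWeight_le {c : ℝ} (hc : 0 < c) {N : ℕ} (hN : 126 ≤ N) :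
    ∑ k ∈ range (2 * N + 1), apWeight c N k ≤ 9 * N * Real.log N := by
  rw [sum_apWeight_eq]
  exact (sum_hbWeight_le c N).trans (mass_le hc hN)

/-- **F3 PROVED** (`C'' = 45`, `N₀ = 126`). [this line] -/
theorem readoutAP_holds : ReadoutAP := by
  intro c hc
  refine ⟨45, 126, fun N hN hno => ?_⟩
  set M : ℕ := 2 * N with hMdef
  have hN0 : (0 : ℝ) < N := by exact_mod_cast (show 0 < N by omega)
  have hM0 : (0 : ℝ) < M := by exact_mod_cast (show 0 < M by omega)
  have hM1 : (1 : ℝ) ≤ M := by exact_mod_cast (show 1 ≤ M by omega)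
  have hNM' : (N : ℝ) ≤ M := by exact_mod_cast (show N ≤ M by omega)
  have hLN1 : 1 ≤ Real.log N := by
    rw [Real.le_log_iff_exp_le hN0]
    have := Real.exp_one_lt_d9
    have h3 : (3 : ℝ) ≤ N := by exact_mod_cast (show 3 ≤ N by omega)
    linarith
  have hLN0 : 0 ≤ Real.log N := by linarith
  have hLNM : Real.log N ≤ Real.log M := Real.log_le_log hN0 hNM'
  have hL1 : 1 ≤ Real.log M := hLN1.trans hLNM
  have hL0 : 0 ≤ Real.log M := by linarith
  have hFnn : ∀ n : Fin 3 → ℕ, 0 ≤ vmWeight M (n 0) * vmWeight M (n 1) * apWeight c N (n 2) :=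
    fun n => mul_nonneg (mul_nonneg (vmWeight_nonneg _ _) (vmWeight_nonneg _ _))
      (apWeight_nonneg _ _ _)
  -- Step 1: under the no-AP hypothesis, triples with `n₀ ≠ n₁` both prime vanish
  have hzero : ∀ n ∈ Finset.Nat.antidiagonalTuple 3 M, (n 0).Prime → (n 1).Prime → n 0 ≠ n 1 →
      vmWeight M (n 0) * vmWeight M (n 1) * apWeight c N (n 2) = 0 := by
    intro n hn h0 h1 hne
    by_cases hw : apWeight c N (n 2) = 0
    · simp [hw]
    · exfalso
      obtain ⟨hke, hr⟩ := apWeight_ne_zero hw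
      obtain ⟨x, y, hx, hy, hp, hval, hlt⟩ := exists_of_hbRep_ne_zero hr
      have hke' : n 2 % 2 = 0 := Nat.even_iff.1 hke
      have hsum := hn
      rw [Finset.Nat.mem_antidiagonalTuple, Fin.sum_univ_three] at hsum
      have h2le : n 2 ≤ M := by omega
      have hAP : n 0 + n 1 = 2 * (N - n 2 / 2) := by omega
      rcases lt_or_gt_of_ne hne with hlt' | hgt'
      · refine hno ⟨n 0, n 1, x, y, hx, hy, h0, h1, hp, ?_, ?_, ?_, ?_⟩
        · rw [hval]; omega
        · rw [hval]; omega
        · rw [hval]; exact hlt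
        · rw [hval]; omega
      · refine hno ⟨n 1, n 0, x, y, hx, hy, h1, h0, hp, ?_, ?_, ?_, ?_⟩
        · rw [hval]; omega
        · rw [hval]; omega
        · rw [hval]; exact hlt
        · rw [hval]; omega
  -- Step 2: split `T = ∑_{n₀, n₁ prime} + ∑_{¬(n₀, n₁ prime)}`; the first part is the prime diagonal
  have hdiag : ∑ n ∈ (Finset.Nat.antidiagonalTuple 3 M).filter (fun n => (n 0).Prime ∧ (n 1).Prime), vmWeight M (n 0) * vmWeight M (n 1) * apWeight c N (n 2) ≤
      ∑ n ∈ (Finset.Nat.antidiagonalTuple 3 M).filter (fun n => n 0 = n 1), vmWeight M (n 0) * vmWeight M (n 1) * apWeight c N (n 2) := by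
    have h1 : ∑ n ∈ (Finset.Nat.antidiagonalTuple 3 M).filter (fun n => (n 0).Prime ∧ (n 1).Prime), vmWeight M (n 0) * vmWeight M (n 1) * apWeight c N (n 2) =
        ∑ n ∈ (Finset.Nat.antidiagonalTuple 3 M).filter (fun n => (n 0).Prime ∧ (n 1).Prime), (if n 0 = n 1 then vmWeight M (n 0) * vmWeight M (n 1) * apWeight c N (n 2) else 0) := by
      refine Finset.sum_congr rfl fun n hn => ?_
      obtain ⟨hn', hp0, hp1⟩ := Finset.mem_filter.mp hn
      split_ifs with h
      · rfl
      · exact hzero n hn' hp0 hp1 h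
    rw [h1, ← Finset.sum_filter, Finset.filter_filter]
    refine Finset.sum_le_sum_of_subset_of_nonneg (fun n hn => ?_) fun n _ _ => hFnn n
    rw [Finset.mem_filter] at hn ⊢
    exact ⟨hn.1, hn.2.2⟩
  -- the prime diagonal: inject `n ↦ n 2` into `range (M+1)`, each term `≤ log² M · w(n 2)`
  have hdiag2 : ∑ n ∈ (Finset.Nat.antidiagonalTuple 3 M).filter (fun n => n 0 = n 1), vmWeight M (n 0) * vmWeight M (n 1) * apWeight c N (n 2) ≤
      Real.log M ^ 2 * ∑ k ∈ range (M + 1), apWeight c N k := by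
    have hinj : Set.InjOn (fun n : Fin 3 → ℕ => n 2) ↑((Finset.Nat.antidiagonalTuple 3 M).filter (fun n => n 0 = n 1)) := by
      intro n hn n' hn' h
      simp only [Finset.coe_filter, Set.mem_setOf_eq, Finset.Nat.mem_antidiagonalTuple,
        Fin.sum_univ_three] at hn hn'
      simp only at h
      funext j
      fin_cases j
      · simp only [Fin.zero_eta]; omega
      · simp only [Fin.mk_one]; omega
      · simp only [Fin.reduceFinMk]; omega
    have hsub : ((Finset.Nat.antidiagonalTuple 3 M).filter (fun n => n 0 = n 1)).image (fun n : Fin 3 → ℕ => n 2) ⊆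
        range (M + 1) := by
      intro k hk
      obtain ⟨n, hn, rfl⟩ := Finset.mem_image.mp hk
      have hT := (Finset.mem_filter.mp hn).1
      exact mem_range.2 (Nat.lt_succ_of_le (apply_le_of_mem_antidiagonalTuple' hT 2))
    have hterm : ∀ n ∈ (Finset.Nat.antidiagonalTuple 3 M).filter (fun n => n 0 = n 1), vmWeight M (n 0) * vmWeight M (n 1) * apWeight c N (n 2) ≤
        Real.log M ^ 2 * apWeight c N (n 2) := by
      intro n hn
      have hT := (Finset.mem_filter.mp hn).1
      have h0 := vmWeight_le_log (apply_le_of_mem_antidiagonalTuple' hT 0)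
      have h1 := vmWeight_le_log (apply_le_of_mem_antidiagonalTuple' hT 1)
      calc vmWeight M (n 0) * vmWeight M (n 1) * apWeight c N (n 2)
          ≤ Real.log M * Real.log M * apWeight c N (n 2) :=
            mul_le_mul_of_nonneg_right (mul_le_mul h0 h1 (vmWeight_nonneg _ _) hL0)
              (apWeight_nonneg _ _ _)
        _ = Real.log M ^ 2 * apWeight c N (n 2) := by ring
    calc ∑ n ∈ (Finset.Nat.antidiagonalTuple 3 M).filter (fun n => n 0 = n 1), vmWeight M (n 0) * vmWeight M (n 1) * apWeight c N (n 2)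
        ≤ ∑ n ∈ (Finset.Nat.antidiagonalTuple 3 M).filter (fun n => n 0 = n 1), Real.log M ^ 2 * apWeight c N (n 2) :=
          Finset.sum_le_sum hterm
      _ = ∑ k ∈ ((Finset.Nat.antidiagonalTuple 3 M).filter (fun n => n 0 = n 1)).image (fun n : Fin 3 → ℕ => n 2),
            Real.log M ^ 2 * apWeight c N k :=
          (Finset.sum_image (f := fun k => Real.log M ^ 2 * apWeight c N k) hinj).symm
      _ ≤ ∑ k ∈ range (M + 1), Real.log M ^ 2 * apWeight c N k :=
          Finset.sum_le_sum_of_subset_of_nonneg hsub fun k _ _ =>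
            mul_nonneg (sq_nonneg _) (apWeight_nonneg _ _ _)
      _ = Real.log M ^ 2 * ∑ k ∈ range (M + 1), apWeight c N k := by rw [Finset.mul_sum]
  -- the non-(prime, prime) part, as in Line E
  have hrest : ∑ n ∈ (Finset.Nat.antidiagonalTuple 3 M).filter (fun n => ¬ ((n 0).Prime ∧ (n 1).Prime)), vmWeight M (n 0) * vmWeight M (n 1) * apWeight c N (n 2) ≤
      ∑ n ∈ (Finset.Nat.antidiagonalTuple 3 M).filter (fun n => ¬ (n 0).Prime), vmWeight M (n 0) * vmWeight M (n 1) * apWeight c N (n 2) +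
        ∑ n ∈ (Finset.Nat.antidiagonalTuple 3 M).filter (fun n => ¬ (n 1).Prime), vmWeight M (n 0) * vmWeight M (n 1) * apWeight c N (n 2) := by
    have hsub : (Finset.Nat.antidiagonalTuple 3 M).filter (fun n => ¬ ((n 0).Prime ∧ (n 1).Prime)) ⊆
        (Finset.Nat.antidiagonalTuple 3 M).filter (fun n => ¬ (n 0).Prime) ∪ (Finset.Nat.antidiagonalTuple 3 M).filter (fun n => ¬ (n 1).Prime) := by
      intro n hn
      rw [Finset.mem_union, Finset.mem_filter, Finset.mem_filter]
      obtain ⟨hn, h⟩ := Finset.mem_filter.mp hn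
      by_cases h0 : (n 0).Prime
      · exact Or.inr ⟨hn, fun h1 => h ⟨h0, h1⟩⟩
      · exact Or.inl ⟨hn, h0⟩
    refine (Finset.sum_le_sum_of_subset_of_nonneg hsub fun n _ _ => hFnn n).trans ?_
    have hui := Finset.sum_union_inter
      (s₁ := (Finset.Nat.antidiagonalTuple 3 M).filter (fun n => ¬ (n 0).Prime)) (s₂ := (Finset.Nat.antidiagonalTuple 3 M).filter (fun n => ¬ (n 1).Prime)) (f := fun n : Fin 3 → ℕ => vmWeight M (n 0) * vmWeight M (n 1) * apWeight c N (n 2))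
    have hi : 0 ≤ ∑ n ∈ (Finset.Nat.antidiagonalTuple 3 M).filter (fun n => ¬ (n 0).Prime) ∩ (Finset.Nat.antidiagonalTuple 3 M).filter (fun n => ¬ (n 1).Prime), vmWeight M (n 0) * vmWeight M (n 1) * apWeight c N (n 2) :=
      Finset.sum_nonneg fun n _ => hFnn n
    linarith
  have hsplit : ternarySum (vmWeight M) (vmWeight M) (apWeight c N) M =
      ∑ n ∈ (Finset.Nat.antidiagonalTuple 3 M).filter (fun n => (n 0).Prime ∧ (n 1).Prime), vmWeight M (n 0) * vmWeight M (n 1) * apWeight c N (n 2) +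
        ∑ n ∈ (Finset.Nat.antidiagonalTuple 3 M).filter (fun n => ¬ ((n 0).Prime ∧ (n 1).Prime)), vmWeight M (n 0) * vmWeight M (n 1) * apWeight c N (n 2) := by
    unfold ternarySum
    rw [← Finset.sum_filter_add_sum_filter_not (Finset.Nat.antidiagonalTuple 3 M) (fun n => (n 0).Prime ∧ (n 1).Prime)]
  -- Step 3: the two filtered sums with a non-prime coordinate
  have hsymm : ∑ n ∈ (Finset.Nat.antidiagonalTuple 3 M).filter (fun n => ¬ (n 1).Prime), vmWeight M (n 0) * vmWeight M (n 1) * apWeight c N (n 2) =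
      ∑ n ∈ (Finset.Nat.antidiagonalTuple 3 M).filter (fun n => ¬ (n 0).Prime), vmWeight M (n 0) * vmWeight M (n 1) * apWeight c N (n 2) :=
    sum_filter_not_prime_one_eq (vmWeight M) (apWeight c N) M
  have hS0 := sum_filter_not_prime_zero_le' M (f₃ := apWeight c N) (apWeight_nonneg c N)
  -- Step 4: numerics
  have hψ : ψ (M : ℝ) - θ (M : ℝ) ≤ 2 * √(M : ℝ) * Real.log M := Chebyshev.psi_sub_theta_le hM1
  have hmass : ∑ k ∈ range (M + 1), apWeight c N k ≤ 9 * M * Real.log M := by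
    have h := sum_apWeight_le hc hN
    rw [← hMdef] at h
    refine h.trans ?_
    exact mul_le_mul (mul_le_mul_of_nonneg_left hNM' (by norm_num)) hLNM hLN0 (by positivity)
  have hmass0 : 0 ≤ ∑ k ∈ range (M + 1), apWeight c N k :=
    Finset.sum_nonneg fun k _ => apWeight_nonneg c N k
  have hprod : (ψ (M : ℝ) - θ (M : ℝ)) * Real.log M * ∑ k ∈ range (M + 1), apWeight c N k ≤
      2 * √(M : ℝ) * Real.log M * Real.log M * (9 * M * Real.log M) :=
    mul_le_mul (mul_le_mul_of_nonneg_right hψ hL0) hmass hmass0 (by positivity)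
  have hsqrt : √(M : ℝ) * M = (M : ℝ) ^ ((3 : ℝ) / 2) := by
    rw [Real.sqrt_eq_rpow, ← Real.rpow_add_one hM0.ne']; norm_num
  have hsqrt1 : 1 ≤ √(M : ℝ) := by rw [Real.one_le_sqrt]; exact hM1
  have hM32 : (M : ℝ) ≤ (M : ℝ) ^ ((3 : ℝ) / 2) := by
    rw [← hsqrt]
    have := mul_le_mul_of_nonneg_right hsqrt1 hM0.le
    linarith
  have hL4 : Real.log M ^ 3 ≤ Real.log M ^ (4 : ℝ) := by
    rw [show Real.log M ^ (4 : ℝ) = Real.log M ^ (4 : ℕ) by exact_mod_cast Real.rpow_natCast _ 4]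
    exact pow_le_pow_right₀ hL1 (by norm_num)
  have hL3 : 0 ≤ Real.log M ^ 3 := by positivity
  have hM32' : 0 ≤ (M : ℝ) ^ ((3 : ℝ) / 2) := by positivity
  have hdiag3 : Real.log M ^ 2 * ∑ k ∈ range (M + 1), apWeight c N k ≤
      9 * (M : ℝ) ^ ((3 : ℝ) / 2) * Real.log M ^ 3 := by
    calc Real.log M ^ 2 * ∑ k ∈ range (M + 1), apWeight c N k
        ≤ Real.log M ^ 2 * (9 * M * Real.log M) := mul_le_mul_of_nonneg_left hmass (sq_nonneg _)
      _ = 9 * (M : ℝ) * Real.log M ^ 3 := by ring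
      _ ≤ 9 * (M : ℝ) ^ ((3 : ℝ) / 2) * Real.log M ^ 3 := by gcongr
  calc ternarySum (vmWeight M) (vmWeight M) (apWeight c N) M
      ≤ Real.log M ^ 2 * ∑ k ∈ range (M + 1), apWeight c N k +
          2 * ((ψ (M : ℝ) - θ (M : ℝ)) * Real.log M * ∑ k ∈ range (M + 1), apWeight c N k) := by
        rw [hsplit]; linarith
    _ ≤ 9 * (M : ℝ) ^ ((3 : ℝ) / 2) * Real.log M ^ 3 +
          2 * (2 * √(M : ℝ) * Real.log M * Real.log M * (9 * M * Real.log M)) := by linarith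
    _ = 9 * (M : ℝ) ^ ((3 : ℝ) / 2) * Real.log M ^ 3 + 36 * (√(M : ℝ) * M) * Real.log M ^ 3 := by
        ring
    _ = 45 * (M : ℝ) ^ ((3 : ℝ) / 2) * Real.log M ^ 3 := by rw [hsqrt]; ring
    _ ≤ 45 * (M : ℝ) ^ ((3 : ℝ) / 2) * Real.log M ^ (4 : ℝ) := by gcongr

end F3proof

/-! ## The shared supports, the Assembly and the target (items 19666, 19667, 19668, 19662) -/

section Closing

/-- **stmt-Parity-19666 (support E2, shared).** Same body as the Literature fact; closed by the Literature
theorem (p410505). [Vaughan1997 §3.1] -/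
theorem roughModelFourierApprox_holds : RoughModelFourierApprox :=
  Literature.NumberTheory.Sieve.CubicMinorant.roughModelFourierApprox_holds

/-- **stmt-Parity-19667 (support E4b, shared).** Same body as the Literature fact; closed by the Literature
theorem (p410644). [Vaughan1986Cubes; Vaughan1997 Lemma 2.5] -/
theorem hbFourierFourthMoment_holds : HBFourierFourthMoment :=
  Literature.NumberTheory.Sieve.CubicMinorant.hbFourierFourthMoment_holds

/-- **stmt-Parity-19668 (assembly).** `MainTermLowerAP → ErrorTermBoundAP → ReadoutAP → RoughModelFourierApprox →
HBFourierFourthMoment → HeathBrownPrimeAP3` is exactly the route's deciding theorem `closes`. -/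
theorem assembly_holds : Assembly := fun h₁ h₂ h₃ hE2 hE4b => closes h₁ h₂ h₃ hE2 hE4b

/-- **stmt-Parity-19662 (target = rung leaf): for all large `N` there are primes `p < x³+2y³ < r` in
arithmetic progression (`p + r = 2(x³+2y³)`, `x, y ≥ 1`) with `N/2 < x³+2y³ ≤ N`.** All five hypotheses of
`closes` are theorems. Ledger FRONTIER; no bearing on prime pairs / parity / GHL.
[HeathBrownActa2001, GreenTao2006Restriction] -/
theorem heathBrownPrimeAP3_holds : HeathBrownPrimeAP3 :=
  closes mainTermLowerAP_holds errorTermBoundAP_holds readoutAP_holds roughModelFourierApprox_holds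
    hbFourierFourthMoment_holds

end Closing

end Summit.Parity.GeneralizedHardyLittlewood.Theses.HeathBrownPrimeAP3

end
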